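import Literature.AlgebraicGeometry.Motives.AlgebraicEquivalenceFamilyFiber
import Literature.AlgebraicGeometry.Motives.CyclesDivisorDimensionProofs
import Mathlib.RingTheory.KrullDimension.Regular
import HarnessLib

/-!
# Points of the fibres `W_t` of a family over a smooth curve: codimension one and dimension

Third step towards the named fact `map_familyFiberCycle_eq_finrank_smul`
(`Motives/AlgebraicEquivalencePushforwardFacts`; Fulton, *Intersection Theory*, Prop. 10.1 (a) at
the level of cycles): the dimension bookkeeping for the fibre `W_t ↪ Z` (`familyFiber`) of a
closed subscheme `W ↪ Z ×ₖ T` at a rational point `t ∈ T(k)` of an integral curve `T` smooth over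
`k`, when `W` is integral and dominates `T` (Fulton §10.1: for `T` a non-singular curve,
"`X_t` is an effective Cartier divisor on `𝒳`"; Fulton §10.3, Ex. 10.3.2 for the generators of
algebraic equivalence).

* `AlgPoints.isClosedImmersion_toSpecHom`, `isClosedImmersion_sliceAt_left` (theorems, to be
  invoked with `haveI`): a rational point of
  a `k`-scheme locally of finite type is a closed immersion `Spec k ⟶ T` (closed point of
  dimension `0`, `AlgPoints.height_apply_eq_zero`), hence so are the slices `X ⟶ X ×ₖ T` and the
  projections `W_t ⟶ W` (base changes).
* `snd_fst_familyFiber_apply`, `exists_fst_familyFiber_eq`: the points of `W_t` are exactly the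
  points of `W` over `t` (`W_t ≅ W ×_T Spec κ(t)`, `Motives/AlgebraicEquivalenceFamilyFiber`).
* `fst_familyFiber_apply_ne_top`, `height_familyFiber_lt_height_top`: points of `W_t` are not
  the generic point of `W` (it lies over the generic point of `T`), so have dimension `< dim W`.
* `coheight_fst_familyFiber_eq_one_of_isMax` (**Krull**): a maximal point `w` of `W_t` (generic
  point of an irreducible component) lies over a point `v ∈ W` with `dim 𝒪_{W,v} = 1`, because
  `𝒪_{W_t,w} = 𝒪_{W,v} ⧸ π 𝒪_{W,v}` (`length_stalk_familyFiber_eq`; `π ≠ 0` a uniformiser of the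
  discrete valuation ring `𝒪_{T,t}`, nonzero in the domain `𝒪_{W,v}` as `W → T` is dominant) is
  Artinian and `dim 𝒪_{W,v} = dim(𝒪_{W,v} ⧸ π) + 1` (Stacks 00KW).
* `height_familyFiber_add_one_eq_of_isMax`, `isMax_familyFiber_of_height_add_one_eq`: hence the
  maximal points of `W_t` are exactly its points of dimension `dim W - 1` (dimension formula on
  the variety `W`, Stacks 0A21, `Scheme.height_add_coheight_eq_height_top`): the components of
  the Cartier divisor `W_t ⊂ W` have codimension one (Fulton §10.1, App. B.2).

## References

* W. Fulton, *Intersection Theory*, 2nd ed. (1998), §10.1, §10.3 (Ex. 10.3.2), App. B.2.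
* The Stacks Project, Tags 00KW (`dim R/xR + 1 = dim R`), 0A21 (dimension of varieties).
-/

universe u

open CategoryTheory AlgebraicGeometry Limits MonoidalCategory Order IsLocalRing

noncomputable section

namespace Literature.AlgebraicGeometry.Motives

/-! ### Rational points are closed immersions; slices and fibre projections are closed immersions -/

section ClosedPoint

variable {k : Type u} [Field k] {X T : SchemeOver k}

/-- A rational point of a `k`-scheme locally of finite type is a closed immersion
`Spec k ⟶ T` (a preimmersion with closed image: the underlying point has dimension `0`, i.e. is
a closed point). [folklore] -/
theorem AlgPoints.isClosedImmersion_toSpecHom (T : SchemeOver k) [LocallyOfFiniteType T.hom]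
    (t : AlgPoints T k) : IsClosedImmersion t.toSpecHom := by
  haveI : IsPreimmersion t.toSpecHom := AlgPoints.isPreimmersion_left t
  refine IsClosedImmersion.of_isPreimmersion _ ?_
  have hmin : IsMin (t.toSpecHom.base default) := by
    rw [show (default : ↥(Spec (CommRingCat.of k))) = closedPoint k from Subsingleton.elim _ _]
    exact Order.height_eq_zero.mp (AlgPoints.height_apply_eq_zero T t)
  rw [Set.range_unique, ← closure_subset_iff_isClosed]
  intro b hb
  have hyb : t.toSpecHom.base default ⤳ b := specializes_iff_mem_closure.mpr hb
  have hle : b ≤ t.toSpecHom.base default := Scheme.le_iff_specializes.mpr hyb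
  exact ((Scheme.le_iff_specializes.mp (hmin hle)).antisymm hyb).eq

/-- The slice `i_t : X ⟶ X ×ₖ T` at a rational point of a `k`-scheme `T` locally of finite type is
a closed immersion (base change of the closed immersion `t : Spec k ⟶ T`). [folklore] -/
theorem isClosedImmersion_sliceAt_left [LocallyOfFiniteType T.hom] (t : AlgPoints T k) :
    IsClosedImmersion (sliceAt X t).left :=
  MorphismProperty.of_isPullback (isPullback_sliceAt (X := X) t).flip
    (AlgPoints.isClosedImmersion_toSpecHom T t)

end ClosedPoint

/-! ### Points of the fibre of a family over a smooth curve -/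

section FibrePoints

variable {k : Type u} [Field k] {Z T : SchemeOver k} (W : ClosedSubscheme (Z ⊗ T).left)
  (t : AlgPoints T k)

/-- Points of the fibre `W_t` lie over `t`: `pr_T (ι_W (pr w)) = t`. [folklore] -/
lemma snd_fst_familyFiber_apply (w : (familyFiber W t).carrier) :
    (W.ι ≫ (CartesianMonoidalCategory.snd Z T).left).base
        ((pullback.fst W.ι (sliceAt Z t).left).base w) =
      t.toSpecHom.base (closedPoint k) := by
  have h := congrArg (fun φ ↦ φ.base w) (isPullback_familyFiber W t).w
  simp only [Scheme.Hom.comp_base, TopCat.coe_comp, Function.comp_apply] at h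
  calc (W.ι ≫ (CartesianMonoidalCategory.snd Z T).left).base
        ((pullback.fst W.ι (sliceAt Z t).left).base w)
      = t.toSpecHom.base (Z.hom.base ((pullback.snd W.ι (sliceAt Z t).left).base w)) := h
    _ = t.toSpecHom.base (closedPoint k) := congrArg _ (Subsingleton.elim _ _)

/-- The closed immersion `W_t → W` preserves the dimension of point closures. [folklore] -/
lemma height_familyFiber_eq [LocallyOfFiniteType T.hom] (w : (familyFiber W t).carrier) :
    height w = height ((pullback.fst W.ι (sliceAt Z t).left).base w) :=
  haveI := isClosedImmersion_sliceAt_left (X := Z) t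
  (height_base_eq_of_isClosedImmersion' (pullback.fst W.ι (sliceAt Z t).left) w).symm

/-- Every point of `W` over `t` is (the image of) a point of the fibre `W_t`. [folklore] -/
lemma exists_fst_familyFiber_eq (v : W.carrier)
    (hv : (W.ι ≫ (CartesianMonoidalCategory.snd Z T).left).base v =
      t.toSpecHom.base (closedPoint k)) :
    ∃ w : (familyFiber W t).carrier, (pullback.fst W.ι (sliceAt Z t).left).base w = v := by
  obtain ⟨e, he⟩ := exists_iso_fiber_hom_fiberι_eq W t
  have hmem : v ∈ Set.range ((W.ι ≫ (CartesianMonoidalCategory.snd Z T).left).fiberι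
      (t.toSpecHom.base (closedPoint k))).base := by
    rw [Scheme.Hom.range_fiberι]
    exact hv
  obtain ⟨z, hz⟩ := hmem
  have hq : e.inv ≫ pullback.fst W.ι (sliceAt Z t).left =
      (W.ι ≫ (CartesianMonoidalCategory.snd Z T).left).fiberι
        (t.toSpecHom.base (closedPoint k)) := e.inv_comp_eq.mpr he.symm
  have h := congrArg (fun φ ↦ φ.base z) hq
  simp only [Scheme.Hom.comp_base, TopCat.coe_comp, Function.comp_apply] at h
  exact ⟨e.inv.base z, h.trans hz⟩

variable [IsIntegral W.carrier] [IsIntegral T.left] [SmoothOfRelativeDimension 1 T.hom]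
  [Flat (W.ι ≫ (CartesianMonoidalCategory.snd Z T).left)]

/-- Points of the fibre `W_t` of an integral family dominating the curve `T` are not the generic
point of `W` (which lies over the generic point of `T`, not over the closed point `t`).
[folklore] -/
lemma fst_familyFiber_apply_ne_top (w : (familyFiber W t).carrier) :
    (pullback.fst W.ι (sliceAt Z t).left).base w ≠ ⊤ := by
  intro h
  haveI : IsDominant (W.ι ≫ (CartesianMonoidalCategory.snd Z T).left) := isDominant_of_flat _
  have h1 := snd_fst_familyFiber_apply W t w
  rw [h] at h1
  exact AlgPoints.apply_ne_genericPoint t _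
    ((genericPoint_eq_of_isDominant' (W.ι ≫ (CartesianMonoidalCategory.snd Z T).left)).symm.trans
      h1).symm

/-- Points of the fibre `W_t` are strictly below the generic point of `W`. [folklore] -/
lemma fst_familyFiber_apply_lt_top (w : (familyFiber W t).carrier) :
    (pullback.fst W.ι (sliceAt Z t).left).base w < ⊤ := by
  refine lt_iff_le_not_ge.mpr ⟨le_top, fun h ↦ fst_familyFiber_apply_ne_top W t w ?_⟩
  exact ((Scheme.le_iff_specializes.mp h).antisymm (Scheme.le_iff_specializes.mp
    (le_top (a := (pullback.fst W.ι (sliceAt Z t).left).base w)))).eq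

/-- Points of the fibre `W_t` have dimension `< dim W` (if `dim W < ∞`). [folklore] -/
lemma height_familyFiber_lt_height_top (hfin : height (⊤ : W.carrier) < ⊤)
    (w : (familyFiber W t).carrier) : height w < height (⊤ : W.carrier) := by
  haveI : Smooth T.hom := SmoothOfRelativeDimension.smooth 1 T.hom
  haveI : LocallyOfFiniteType T.hom := inferInstance
  rw [height_familyFiber_eq W t w]
  exact height_strictMono (fst_familyFiber_apply_lt_top W t w)
    (lt_of_le_of_lt (height_mono le_top) hfin)

variable [LocallyOfFiniteType Z.hom]

omit [IsIntegral W.carrier] [IsIntegral T.left]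
  [Flat (W.ι ≫ (CartesianMonoidalCategory.snd Z T).left)] in
/-- `W ↪ Z ×ₖ T → Spec k` is locally of finite type (so `W` is locally Noetherian and the
dimension formula applies to it). [folklore] -/
lemma locallyOfFiniteType_ι_comp_hom : LocallyOfFiniteType (W.ι ≫ (Z ⊗ T).hom) := by
  haveI : Smooth T.hom := SmoothOfRelativeDimension.smooth 1 T.hom
  haveI : LocallyOfFiniteType (Z ⊗ T).hom := by
    change LocallyOfFiniteType (pullback.fst Z.hom T.hom ≫ Z.hom)
    infer_instance
  infer_instance

/-- **Maximal points of the fibre have codimension one.** If `w` is the generic point of an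
irreducible component of `W_t` (a maximal point) — `W` an integral family dominating the smooth
curve `T` — then the point `v ∈ W` under it has `dim 𝒪_{W,v} = 1`: `𝒪_{W_t,w} = 𝒪_{W,v} ⧸ π 𝒪_{W,v}`
(`length_stalk_familyFiber_eq`, `π` a uniformiser of `𝒪_{T,t}`, nonzero in the domain `𝒪_{W,v}`
because `W → T` is dominant) is Artinian, and `dim 𝒪_{W,v} = dim (𝒪_{W,v} ⧸ π) + 1` (Mathlib
`ringKrullDim_quotient_span_singleton_succ_eq_ringKrullDim_of_mem_nonZeroDivisors`, Krull's
principal ideal theorem). (Fulton, *Intersection Theory*, §10.1: for `T` a curve `V_t ⊂ 𝒱` is a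
Cartier divisor, so its components have codimension one.) [folklore] -/
theorem coheight_fst_familyFiber_eq_one_of_isMax (w : (familyFiber W t).carrier)
    (hw : IsMax w) : coheight ((pullback.fst W.ι (sliceAt Z t).left).base w) = 1 := by
  haveI : Smooth T.hom := SmoothOfRelativeDimension.smooth 1 T.hom
  haveI : IsLocallyNoetherian Z.left := LocallyOfFiniteType.isLocallyNoetherian Z.hom
  haveI := locallyOfFiniteType_ι_comp_hom W
  haveI : IsLocallyNoetherian W.carrier :=
    LocallyOfFiniteType.isLocallyNoetherian (W.ι ≫ (Z ⊗ T).hom)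
  haveI : IsDominant (W.ι ≫ (CartesianMonoidalCategory.snd Z T).left) := isDominant_of_flat _
  set g := W.ι ≫ (CartesianMonoidalCategory.snd Z T).left with hg
  set v := (pullback.fst W.ι (sliceAt Z t).left).base w with hvdef
  -- a uniformiser `π` of `𝒪_{T, g v}`, nonzero
  obtain ⟨π, hπ⟩ := exists_maximalIdeal_stalk_eq_span T (g.base v)
  have hv : g.base v = t.toSpecHom.base (closedPoint k) := snd_fst_familyFiber_apply W t w
  have hne : maximalIdeal (T.left.presheaf.stalk (g.base v)) ≠ ⊥ := by
    rw [hv]; exact AlgPoints.maximalIdeal_stalk_ne_bot T t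
  have hπ0 : π ≠ 0 := by
    rintro rfl
    exact hne (by rw [hπ, Ideal.span_singleton_eq_bot])
  have hπmem : π ∈ maximalIdeal _ := by rw [hπ]; exact Ideal.mem_span_singleton_self π
  -- its image `a` in `𝒪_{W,v}`: nonzero, in the maximal ideal
  set O := ↑(W.carrier.presheaf.stalk v) with hO
  have ha0 : (g.stalkMap v).hom π ≠ 0 := fun h ↦
    hπ0 (stalkMap_injective_of_isDominant g v (show (g.stalkMap v).hom π = (g.stalkMap v).hom 0 by
      rw [map_zero]; exact h))
  have hamem : (g.stalkMap v).hom π ∈ maximalIdeal O :=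
    (IsLocalRing.mem_maximalIdeal _).mpr fun hu ↦
      (IsLocalRing.mem_maximalIdeal π).mp hπmem (IsLocalHom.map_nonunit π hu)
  -- `𝒪_{W_t, w} ≅ 𝒪_{W,v} ⧸ a`, of finite length
  have hI : (maximalIdeal ↑(T.left.presheaf.stalk (g.base v))).map (g.stalkMap v).hom =
      Ideal.span {(g.stalkMap v).hom π} := by
    rw [hπ, Ideal.map_span, Set.image_singleton]
  have hfin : Module.length O (O ⧸ Ideal.span {(g.stalkMap v).hom π}) ≠ ⊤ := by
    have h := (isGenericComponentPoint_of_isMax hw).ne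
    rw [length_stalk_familyFiber_eq W t w] at h
    rwa [hI] at h
  -- hence `𝒪_{W,v} ⧸ a` is Artinian of dimension `0`, and `dim 𝒪_{W,v} = 1`
  haveI : IsArtinianRing (O ⧸ Ideal.span {(g.stalkMap v).hom π}) := by
    have hFL : IsFiniteLength O (O ⧸ Ideal.span {(g.stalkMap v).hom π}) :=
      Module.length_ne_top_iff.mp hfin
    rw [isFiniteLength_iff_isNoetherian_isArtinian] at hFL
    exact isArtinian_of_tower O hFL.2
  haveI : Nontrivial (O ⧸ Ideal.span {(g.stalkMap v).hom π}) :=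
    Ideal.Quotient.nontrivial_iff.mpr (by
      rw [Ne, Ideal.span_singleton_eq_top]
      exact fun hu ↦ (IsLocalRing.mem_maximalIdeal _).mp hamem hu)
  have hdim0 : ringKrullDim (O ⧸ Ideal.span {(g.stalkMap v).hom π}) = 0 :=
    ringKrullDimZero_iff_ringKrullDim_eq_zero.mp
      ((isArtinianRing_iff_krullDimLE_zero).mp inferInstance)
  have hdim1 : ringKrullDim O = 1 := by
    rw [← ringKrullDim_quotient_span_singleton_succ_eq_ringKrullDim_of_mem_nonZeroDivisors
      (mem_nonZeroDivisors_of_ne_zero ha0) hamem, hdim0, zero_add]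
  have h := ringKrullDim_stalk_eq_coheight v
  rw [hdim1] at h
  exact_mod_cast h.symm

/-- **Maximal points of the fibre have dimension `dim W - 1`**: for `w` a maximal point of `W_t`,
`height w + 1 = dim W` (codimension one, `coheight_fst_familyFiber_eq_one_of_isMax`, and the
dimension formula `height + coheight = dim` on the integral scheme `W` locally of finite type over
`k`, Stacks 0A21). [folklore] -/
theorem height_familyFiber_add_one_eq_of_isMax (w : (familyFiber W t).carrier) (hw : IsMax w) :
    height w + 1 = height (⊤ : W.carrier) := by
  haveI : Smooth T.hom := SmoothOfRelativeDimension.smooth 1 T.hom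
  haveI := locallyOfFiniteType_ι_comp_hom W
  have h1 := coheight_fst_familyFiber_eq_one_of_isMax W t w hw
  have h2 := Scheme.height_add_coheight_eq_height_top (W.ι ≫ (Z ⊗ T).hom)
    ((pullback.fst W.ι (sliceAt Z t).left).base w)
  rw [h1] at h2
  rw [height_familyFiber_eq W t w, h2]

omit [LocallyOfFiniteType Z.hom] in
/-- Conversely, a point of the fibre `W_t` of dimension `dim W - 1` is a maximal point of `W_t`
(all points of `W_t` have dimension `< dim W`). [folklore] -/
theorem isMax_familyFiber_of_height_add_one_eq (hfin : height (⊤ : W.carrier) < ⊤)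
    (w : (familyFiber W t).carrier) (h : height w + 1 = height (⊤ : W.carrier)) : IsMax w := by
  by_contra hw
  obtain ⟨w', hw'⟩ := not_isMax_iff.mp hw
  have h1 : height w + 1 ≤ height w' := Order.height_add_one_le hw'
  have h2 := height_familyFiber_lt_height_top W t hfin w'
  rw [h] at h1
  exact (lt_irrefl _) (lt_of_le_of_lt h1 h2)

end FibrePoints

end Literature.AlgebraicGeometry.Motives

end
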